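import Summits.ValiantsHypothesis.ValiantsHypothesis.Cruxes.OrbitDimensionBound.Lines.PowerLadder

set_option linter.dupNamespace false

/-!
# F4 ON-PATH lemma `S → Rung` for the rung `SquareShadow` (ladder `Lines/PowerLadder.lean`, forward rung g8)

`ValiantsHypothesis → SquareShadow`, BY NAME and sorry-free (`PowerLadder.squareShadow_of_summit`,
`SquareShadow_of_ValiantsHypothesis`): a p-bounded sequence of `T_Λ`-equivariant affine determinantal representations of
`per_n ^ 2` gives p-bounded circuits for `per_n ^ 2` (`L(det B) ≤ L(DET_m) + Σ L(B[i,j])`), hence — by the ladder's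
Kaltofen-free ROOT EXTRACTION `complexity_le_of_pow` (truncated binomial series `(1+v)^{1/k}` modulo `𝔪^{n+1}`, one
homogeneous-component pass; `per_n(𝟙) = n! ≠ 0`) — p-bounded circuits for `per_n`, i.e. `PER` p-computable, i.e.
`VP_ℂ = VNP_ℂ` (`isPComputable_perPoly_complex_iff`).  Registered as an `aesop` SAFE rule in the ladder, so the tribunal's
forward kernel closes `S → SquareShadow` by `intro h; aesop`.  Every notch `k ≥ 1` is on the path.
-/

namespace Summit.ValiantsHypothesis.ValiantsHypothesis.Cruxes.OrbitDimensionBound.Power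

/-- **ON-PATH `S → PowerShadow k`** for every notch `k ≥ 1` (F4 name shape). [cite: Burgisser2000, Rem. 2.11, Thm. 2.21] -/
theorem PowerShadow_of_ValiantsHypothesis (k : ℕ) (hk : 1 ≤ k) : _root_.ValiantsHypothesis → PowerShadow k :=
  powerShadow_of_summit k hk

/-- The kernel's structural test, replayed on the rung (closed by the registered safe rule). -/
example : _root_.ValiantsHypothesis → SquareShadow := by
  intro h; aesop

/-- The same, by name. -/
example : _root_.ValiantsHypothesis → SquareShadow := SquareShadow_of_ValiantsHypothesis

/-- The cube notch, for illustration. -/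
example : _root_.ValiantsHypothesis → PowerShadow 3 := PowerShadow_of_ValiantsHypothesis 3 (by norm_num)

/-- The root extraction behind it, as a standalone statement: `L(per_n)` is polynomially bounded by `L(per_n ^ k)`. -/
example (n k : ℕ) (hk : 1 ≤ k) :
    Literature.Computability.AlgebraicComplexity.complexity (Literature.Computability.AlgebraicComplexity.perPoly (Fin n) ℂ) ≤
      (n + 2) ^ 2 * ((n + 1) * ((n + 1) *
        (Literature.Computability.AlgebraicComplexity.complexity
          (Literature.Computability.AlgebraicComplexity.perPoly (Fin n) ℂ ^ k) + n * n + 3) + 1) + (n + 1))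
        + (n + 1) + 1 + n * n :=
  complexity_perPoly_le_of_pow n k hk

end Summit.ValiantsHypothesis.ValiantsHypothesis.Cruxes.OrbitDimensionBound.Power
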